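import Summits.BirchSwinnertonDyer.Rank1Residual.Additive.X3BranchKernelFamilyModPowers
import Summits.BirchSwinnertonDyer.Rank1Residual.Additive.X3BranchCubesModNine
import Summits.BirchSwinnertonDyer.Rank1Residual.Additive.X3BranchLayerKummerData
import Summits.BirchSwinnertonDyer.Rank1Residual.Additive.X3BranchLayerNumberField
import Literature.NumberTheory.DiophantineGeometry.SUnitTheorem
import HarnessLib

/-!
# X3 degenerate road, brick U5a: `S`-units that are cubes modulo `9`, independent modulo cubes
# (cell `bsd-eis`, seat `bsd-eis-x3` gen 9; route K1 `AdditiveBranchIMC`, crux `GordTwoRankZeroOffCaseOne`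
# — supports only; THEOREMS ONLY)

HONEST FRAMING (`run/shared/lean/pub/bsd-eis/README.md` §4): the programme's target of record is the full
Birch–Swinnerton-Dyer formula for every `E/ℚ` of analytic rank `≤ 1`; this file is brick U5a of the
CLASS-LEVEL lower bound `3^{σ(S₀)−1} ≤ #U(W[3]/Φ₀)` (`x3-MEMO-11.md` §2) on the degenerate X3♯(G-ord)
rows at `p = 3`.  For a number field `K`, `m₀ ≥ 1` prime to `3`, `S` = the primes of `K` dividing `m₀`
and every prime of `K` above `3` of ODD absolute ramification index, it produces
`k ≥ rank 𝓞_K^× + #S − [K : ℚ]` `S`-units `u_j` with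
* `u_j · d_j³ = 1 + 9 t_j` for `S`-integers `d_j ≠ 0`, `t_j` (the local condition at `3` in congruence form),
* `∏ u_j^{c_j} ∈ (torsion)·(cubes) ⇒ c = 0` (independence modulo cubes),
by Dirichlet's `S`-unit theorem (tree, PROVED: `sUnit_exist_unique_eq_mul_prod`), the count
`#((R/9R)ˣ/cubes) ≤ #(𝓞_K/3) = 3^{[K:ℚ]}` (U1 `natCard_units_quot_cubes_le`, U7) and the linear algebra of
brick D (`exists_kernel_family`).  Nothing is booked here.
References: [Omeara1963] §33F Thm. 33:10; [NeukirchANT1999] Ch. I (11.6), Ch. II (3.8), (5.7);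
[GreenbergVatsal2000] §2 pp. 26–30.
-/

set_option autoImplicit false

noncomputable section

open scoped Classical NumberField

namespace Summit.BirchSwinnertonDyer.Rank1Residual.Additive

namespace KummerFamily

open NumberField IsDedekindDomain WithZero Literature.NumberTheory.DiophantineGeometry

/-- **If the unit `u` of `R` is a cube in `(R/9R)ˣ` then `u·d³ = 1 + 9t` with `d ≠ 0`**: either the
witness of `exists_congruence_of_mk_mem_range` is nonzero, or `9t = −1` makes `9` a unit and `d = 1`
works. [folklore] -/
theorem exists_congruence_ne_zero_of_mk_mem_range {R : Type*} [CommRing R] [Nontrivial R] (u : Rˣ)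
    (hu : Units.map (Ideal.Quotient.mk (Ideal.span {(9 : R)})).toMonoidHom u ∈
      (@powMonoidHom (R ⧸ Ideal.span {(9 : R)})ˣ _ 3).range) :
    ∃ d t : R, d ≠ 0 ∧ (u : R) * d ^ 3 = 1 + 9 * t := by
  obtain ⟨d, t, h⟩ := exists_congruence_of_mk_mem_range u hu
  by_cases hd : d = 0
  · rw [hd, zero_pow three_ne_zero, mul_zero] at h
    refine ⟨1, ((u : R) - 1) * -t, one_ne_zero, ?_⟩
    linear_combination (1 - (u : R)) * h
  · exact ⟨d, t, hd, h⟩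

/-- **Brick D applied to units modulo `9`** (generic commutative ring `R`, abelian group `A → Rˣ`):
from generators `ε` of `A` modulo a subgroup `T` with no relations modulo `T`, and
`#((R/9R)ˣ/cubes) ≤ 3^d`, get `k ≥ r − d` elements of `A` that are cubes modulo `9R` and independent
modulo `T·A³`. [folklore] -/
theorem exists_kernel_family_cubes_mod_nine {R : Type*} [CommRing R] {A : Type*} [CommGroup A]
    (ψ : A →* Rˣ) [Finite ((R ⧸ Ideal.span {(9 : R)})ˣ)] {d : ℕ}
    (hcard : Nat.card ((R ⧸ Ideal.span {(9 : R)})ˣ ⧸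
      (@powMonoidHom (R ⧸ Ideal.span {(9 : R)})ˣ _ 3).range) ≤ 3 ^ d)
    {r : ℕ} (ε : Fin r → A) (T : Subgroup A)
    (hgen : ∀ y : A, ∃ t ∈ T, ∃ m : Fin r → ℤ, y = t * ∏ i, ε i ^ m i)
    (hind : ∀ n : Fin r → ℤ, (∏ i, ε i ^ n i) ∈ T → n = 0) :
    ∃ (k : ℕ) (u : Fin k → A), r ≤ k + d ∧
      (∀ j, Units.map (Ideal.Quotient.mk (Ideal.span {(9 : R)})).toMonoidHom (ψ (u j)) ∈
        (@powMonoidHom (R ⧸ Ideal.span {(9 : R)})ˣ _ 3).range) ∧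
      ∀ (c : Fin k → ZMod 3) (t : A) (_ : t ∈ T) (y : A),
        (∏ j, u j ^ (c j).val) = t * y ^ 3 → c = 0 := by
  haveI : Fact (Nat.Prime 3) := ⟨Nat.prime_three⟩
  have hB : ∀ b : (R ⧸ Ideal.span {(9 : R)})ˣ ⧸ (@powMonoidHom (R ⧸ Ideal.span {(9 : R)})ˣ _ 3).range,
      b ^ 3 = 1 := by
    intro b
    obtain ⟨x, rfl⟩ := QuotientGroup.mk_surjective b
    rw [← QuotientGroup.mk_pow, QuotientGroup.eq_one_iff]
    exact ⟨x, rfl⟩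
  let Φ : A →* (R ⧸ Ideal.span {(9 : R)})ˣ ⧸ (@powMonoidHom (R ⧸ Ideal.span {(9 : R)})ˣ _ 3).range :=
    (QuotientGroup.mk' _).comp ((Units.map (Ideal.Quotient.mk (Ideal.span {(9 : R)})).toMonoidHom).comp ψ)
  obtain ⟨k, u, hk, hΦ, hindep⟩ := exists_kernel_family (p := 3) ε T hgen hind hB Φ hcard
  refine ⟨k, u, hk, fun j => ?_, hindep⟩
  have h := hΦ j
  rwa [show Φ (u j) = QuotientGroup.mk (Units.map (Ideal.Quotient.mk
    (Ideal.span {(9 : R)})).toMonoidHom (ψ (u j))) from rfl, QuotientGroup.eq_one_iff] at h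

variable {K : Type*} [Field K] [NumberField K]

/-- The set of primes of `K` dividing `m₀ ≠ 0` is finite. [folklore] -/
theorem finite_primes_natCast_mem {m₀ : ℕ} (hm₀ : m₀ ≠ 0) :
    ({v : HeightOneSpectrum (𝓞 K) | (m₀ : 𝓞 K) ∈ v.asIdeal} : Set _).Finite := by
  have hne : Ideal.span {(m₀ : 𝓞 K)} ≠ ⊥ := by
    rw [Ne, Ideal.span_singleton_eq_bot]; exact_mod_cast hm₀
  refine (Ideal.finite_factors hne).subset ?_
  intro v hv
  exact Ideal.dvd_span_singleton.mpr hv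

/-- **Brick U5a.**  `K` a number field whose primes above `3` all have odd absolute ramification index,
`m₀ ≥ 1` prime to `3`, `S` the primes of `K` dividing `m₀`: there are `k ≥ rank(𝓞_K^×) + #S − [K:ℚ]`
`S`-units `u_j`, each satisfying `u_j d_j³ = 1 + 9 t_j` with `S`-integers `d_j ≠ 0`, `t_j`, and
independent modulo (roots of unity)·(cubes of `S`-units).
[cite: Omeara1963, §33F Thm. 33:10] [cite: NeukirchANT1999, Ch. II (5.7)]
[cite: GreenbergVatsal2000, §2 pp. 26–30] -/
theorem exists_kernel_sUnits {m₀ : ℕ} (hm₀ : m₀ ≠ 0) (h3 : ¬ 3 ∣ m₀)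
    (hodd : ∀ v : HeightOneSpectrum (𝓞 K), (3 : 𝓞 K) ∈ v.asIdeal →
      ∃ e : ℕ, Odd e ∧ v.valuation K (3 : K) = exp (-(e : ℤ)))
    (S : Set (HeightOneSpectrum (𝓞 K))) (hS : S = {v | (m₀ : 𝓞 K) ∈ v.asIdeal}) :
    ∃ (k : ℕ) (u : Fin k → S.unit K),
      Units.rank K + Nat.card S ≤ k + Module.finrank ℚ K ∧
      (∀ j, ∃ d t : S.integer K, d ≠ 0 ∧ (((u j : Kˣ) : K)) * (d : K) ^ 3 = 1 + 9 * (t : K)) ∧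
      ∀ (c : Fin k → ZMod 3) (t : S.unit K) (_ : t ∈ CommGroup.torsion (S.unit K)) (y : S.unit K),
        (∏ j, u j ^ (c j).val) = t * y ^ 3 → c = 0 := by
  haveI : Finite S := by rw [hS]; exact (finite_primes_natCast_mem (K := K) hm₀).to_subtype
  -- the target `(R/9R)ˣ / cubes` has order `≤ #(𝓞_K/3) = 3^{[K:ℚ]}`
  have hsurj : Function.Surjective ((Ideal.Quotient.mk (Ideal.span {(9 : S.integer K)})).comp
      (algebraMap (𝓞 K) (S.integer K))) := by
    subst hS; exact surjective_ringOfIntegers_quot_nine (K := K) hm₀ h3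
  obtain ⟨hfin, hcardB⟩ := natCard_units_quot_cubes_le S hodd hsurj
  haveI := hfin
  have hcard : Nat.card ((S.integer K ⧸ Ideal.span {(9 : S.integer K)})ˣ ⧸
      (@powMonoidHom (S.integer K ⧸ Ideal.span {(9 : S.integer K)})ˣ _ 3).range) ≤
      3 ^ Module.finrank ℚ K := by
    have h := natCard_quot_span_natCast K 3
    simp only [Nat.cast_ofNat] at h
    rw [← h]
    exact hcardB
  -- Dirichlet's `S`-unit theorem: generators modulo torsion, no relations modulo torsion
  have hgen : ∀ y : S.unit K, ∃ t ∈ CommGroup.torsion (S.unit K),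
      ∃ m : Fin (Units.rank K + Nat.card S) → ℤ, y = t * ∏ i, NumberField.sUnitFundSystem S i ^ m i := by
    intro y
    obtain ⟨⟨ζ, e⟩, he, -⟩ := NumberField.sUnit_exist_unique_eq_mul_prod S y
    exact ⟨ζ, ζ.2, e, he⟩
  have hind : ∀ n : Fin (Units.rank K + Nat.card S) → ℤ,
      (∏ i, NumberField.sUnitFundSystem S i ^ n i) ∈ CommGroup.torsion (S.unit K) → n = 0 := by
    intro n hn
    obtain ⟨ζe, -, huniq⟩ :=
      NumberField.sUnit_exist_unique_eq_mul_prod S (∏ i, NumberField.sUnitFundSystem S i ^ n i)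
    have hA := huniq (⟨∏ i, NumberField.sUnitFundSystem S i ^ n i, hn⟩, 0) (by simp)
    have hB' := huniq (1, n) (by simp)
    have h := congrArg Prod.snd (hB'.trans hA.symm)
    simpa using h
  obtain ⟨k, u, hk, hmem, hindep⟩ :=
    exists_kernel_family_cubes_mod_nine (S.unitEquivUnitsInteger K).toMonoidHom hcard
      (NumberField.sUnitFundSystem S) (CommGroup.torsion (S.unit K)) hgen hind
  refine ⟨k, u, hk, fun j => ?_, hindep⟩
  obtain ⟨d, t, hd, hdt⟩ := exists_congruence_ne_zero_of_mk_mem_range _ (hmem j)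
  refine ⟨d, t, hd, ?_⟩
  have h9 : ((9 : S.integer K) : K) = 9 := by norm_cast
  have h := congrArg (fun z : S.integer K => (z : K)) hdt
  simpa [h9] using h

end KummerFamily

end Summit.BirchSwinnertonDyer.Rank1Residual.Additive

end
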